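import Literature.MathematicalPhysics.QuantumFieldTheory.Balaban1983to89.B1Eq324BenfattoMarkov
import HarnessLib

/-!
# `Balaban1983to89.B1Eq324BenfattoCondKernelGeneric` — [BenfattoEtAl1978] p. 152 ∕ App. C 2) p. 164 ∕ §5 p. 159: the Gaussian REGRESSION
# dictionary (`condMean`, `condCov`) and the displaced-pavement re-indexing for a GENERAL covariance kernel — no free field, no lattice equation

statement-level skeleton of published theorems with citation tags; proofs where landed; nothing here is a claim about the
Yang–Mills mass gap

WHY THIS MODULE (cell `pub-ymgap`, seat `dag-n08-c` gen 21, INTENT-1; node N08 [Balaban1985UV3]; the [BenfattoEtAl1978] source chain behind the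
(α)-row `h324c`).  The tree's Basic Lemma `…Sect5BasicLemma.basicLemmaPrinted_holds` is proved for [2]'s CONCRETE nearest-neighbour free field
`P0 d α β`; [Balaban1982Higgs1] p. 616 applies the lemma to OTHER Gaussian fields («all the assumptions are satisfied»).  A kernel census of the proof
(`HOME/pub-ymgap-dag-n08-c/N08-BASICLEMMA-KERNEL-CENSUS.md`) shows that two GENERIC facts are proved in the tree only through the free field's lattice
equation: (i) the two-stage conditioning algebra `C^{C∪Γ} = (C^C)^Γ` with its strict positivity (`…TwoStage`, by the maximum principle), and (ii) the
displaced-pavement frame change (`…Translation.P0_map_translate`, by translation INVARIANCE).  This file proves both for an ARBITRARY kernel: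
(i) for any `G : Q₀ × Q₀ → ℝ` whose Gram matrix on the finite set `C ∪ Γ` is positive definite — pure linear algebra (normal equations of the regression,
the Schur complement of a positive definite block matrix, the Crabtree–Haynsworth quotient property); (ii) for any positive semidefinite kernel on any
index type — the push-forward of the centred Gaussian field of `K` under a re-indexing `e` is the centred Gaussian field of `K ∘ (e × e)` (translation
COVARIANCE, which is what the displaced pavements of p. 159 use when the field is not invariant).

WHAT IS PROVED (standard axioms; no `sorry`; no definition).
* §1 RE-INDEXING: `isPosSemidefKernel_reindex`; ★ `gaussianFieldOfKernel_map_reindex` — `(μ_K).map (ω ↦ ω ∘ e) = μ_{K∘(e×e)}`;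
  `integral_gaussianFieldOfKernel_comp_reindex`; the lattice-shift instance `integral_gaussianFieldOfKernel_comp_add_right`
  (`∫ F(z(· + s)) dμ_G = ∫ F dμ_{G(·+s, ·+s)}` — for `G = freeCov` the right side is `μ_G` again by `…Translation.freeCov_add_right`).
* §2 NORMAL EQUATIONS (any `G`, `S` finite with `det G_SS ≠ 0`): `exists_normalEq` (regression coefficients exist); ★ `condCov_eq_of_normalEq`,
  ★ `condMean_eq_of_normalEq` — ANY solution `a` of `Σ_{s∈S} a_s G(s,t) = G(x,t)` (`t ∈ S`) represents `condCov G S x · = G(x,·) − Σ_s a_s G(s,·)` and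
  `condMean G S w x = Σ_s a_s w_s` (uniqueness of the regression); two-family forms `…_of_normalEq₂`.
* §3 SCHUR COMPLEMENT (Gram matrix of `G` on `C ∪ Γ` positive definite, `Γ ∩ C = ∅`): `posDef_covGram_of_subset`; ★ `posDef_covGram_condCov_of_posDef` — the Gram
  matrix of `condCov G C` on `Γ` is positive definite (Schur complement of a positive definite block matrix, via Mathlib's `Matrix.schur_complement_eq₁₁`);
  `isUnit_det_covGram_condCov_of_posDef`.
* §4 TWO STAGES: ★★ `condCov_union_eq_of_posDef` — `condCov G (C ∪ Γ) x y = condCov (condCov G C) Γ x y`; ★★ `condMean_union_eq_of_posDef` —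
  `condMean G (C ∪ Γ) w x = condMean G C w x + condMean (condCov G C) Γ (w − condMean G C w) x`; `condCov_condCov_of_mem_of_posDef`.
  For `G = freeCov d α β` these are `…TwoStage.condCov_union_eq` ∕ `condMean_union_eq` ∕ `posDef_covGram_condCov_freeCov` (there proved by the lattice
  equation; the positive definiteness input is `…AppendixC2.posDef_covGram_freeCov`).
HONEST SCOPE.  Linear algebra and measure transport only; nothing of [2]'s estimates is generalised here; count-neutral for N08; `BasicLemmaPrinted` is
already a theorem and is not used; nothing about d = 4, the continuum, OS axioms, a mass gap or the Clay problem.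
-/

noncomputable section

open Finset Matrix MeasureTheory ProbabilityTheory
open scoped BigOperators Matrix

namespace Literature.MathematicalPhysics.QuantumFieldTheory.Balaban1983to89.B1Eq324BenfattoCondKernelGeneric

open Literature.MathematicalPhysics.QuantumFieldTheory
open Literature.MathematicalPhysics.QuantumFieldTheory.Balaban1983to89.B1Eq324BenfattoLemma

/-! ## §1  Re-indexing a centred Gaussian field (any index type, any positive semidefinite kernel) -/

section Reindex

variable {ι κ : Type*}

/-- **A re-indexed positive semidefinite kernel is positive semidefinite**: `K ∘ (e × e)` for any map `e : κ → ι` (its Gram matrices are principal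
submatrices of Gram matrices of `K`). [cite: BenfattoEtAl1978, (1.1) p.144; §5 p.159 «a new pavement displaced»] -/
theorem isPosSemidefKernel_reindex [DecidableEq ι] {K : ι → ι → ℝ} (hK : IsPosSemidefKernel K) (e : κ → ι) :
    IsPosSemidefKernel (fun i j => K (e i) (e j)) := by
  intro I
  let f : I → (I.image e : Finset ι) := fun i => ⟨e i, Finset.mem_image_of_mem e i.2⟩
  have h : covGram (fun i j => K (e i) (e j)) I = (covGram K (I.image e)).submatrix f f := by
    ext i j
    rfl
  rw [h]
  exact (hK (I.image e)).submatrix f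

/-- kernel: re-indexing of configurations `ω ↦ ω ∘ e` is measurable. [folklore] -/
private theorem measurable_reindex (e : κ → ι) : Measurable fun (ω : ι → ℝ) (k : κ) => ω (e k) :=
  measurable_pi_lambda _ fun k => measurable_pi_apply (e k)

/-- **PUSH-FORWARD OF A GAUSSIAN FIELD UNDER RE-INDEXING** — the law of `(ω_{e(k)})_{k∈κ}` under the centred Gaussian field of `K` is the centred
Gaussian field of the re-indexed kernel `K(e·, e·)`: the image is a centred Gaussian law with that covariance, hence equals it by uniqueness
(`eq_gaussianFieldOfKernel_of_isGaussianProcess`).  For a translation-invariant kernel and `e = (· + s)` this is the invariance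
`…Translation.P0_map_translate`; in general it is translation COVARIANCE — what «we can proceed as before choosing a new pavement displaced by b²∕2»
(p. 159) needs when the field is not invariant. [cite: BenfattoEtAl1978, (1.1) p.144; §5 p.159] -/
theorem gaussianFieldOfKernel_map_reindex [DecidableEq ι] [DecidableEq κ] {K : ι → ι → ℝ} (hK : IsPosSemidefKernel K) (e : κ → ι) :
    (gaussianFieldOfKernel K).map (fun (ω : ι → ℝ) (k : κ) => ω (e k)) =
      gaussianFieldOfKernel (fun i j => K (e i) (e j)) := by
  have hKe := isPosSemidefKernel_reindex hK e
  haveI : IsProbabilityMeasure (gaussianFieldOfKernel K) := isProbabilityMeasure_gaussianFieldOfKernel hK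
  have hTm := measurable_reindex (ι := ι) (κ := κ) e
  haveI : IsProbabilityMeasure ((gaussianFieldOfKernel K).map fun (ω : ι → ℝ) (k : κ) => ω (e k)) :=
    Measure.isProbabilityMeasure_map hTm.aemeasurable
  -- (i) the coordinate process of the image is Gaussian: it is the original process re-indexed by `e`
  have hG : IsGaussianProcess (fun (k : κ) (z : κ → ℝ) => z k)
      ((gaussianFieldOfKernel K).map fun (ω : ι → ℝ) (k : κ) => ω (e k)) := by
    refine ⟨fun I => ⟨?_⟩⟩
    have hrm : Measurable (fun z : κ → ℝ => I.restrict z) := Finset.measurable_restrict I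
    rw [Measure.map_map hrm hTm]
    have h := ((isGaussianProcess_eval_gaussianFieldOfKernel hK).comp_right e).hasGaussianLaw I
    exact h.isGaussian_map
  -- (ii) mean zero, (iii) covariance `K ∘ (e × e)`
  have hm : ∀ k, ∫ z, z k ∂(gaussianFieldOfKernel K).map (fun (ω : ι → ℝ) (k : κ) => ω (e k)) = 0 := by
    intro k
    rw [integral_map hTm.aemeasurable (measurable_pi_apply k).aestronglyMeasurable]
    exact integral_eval_gaussianFieldOfKernel hK (e k)
  have hc : ∀ k l, cov[fun z : κ → ℝ => z k, fun z => z l;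
      (gaussianFieldOfKernel K).map (fun (ω : ι → ℝ) (k : κ) => ω (e k))] = K (e k) (e l) := by
    intro k l
    rw [covariance_map (measurable_pi_apply k).aestronglyMeasurable (measurable_pi_apply l).aestronglyMeasurable
      hTm.aemeasurable]
    change cov[fun ω : ι → ℝ => ω (e k), fun ω => ω (e l); gaussianFieldOfKernel K] = _
    exact covariance_eval_gaussianFieldOfKernel hK (e k) (e l)
  exact eq_gaussianFieldOfKernel_of_isGaussianProcess hKe hG hm hc

/-- **Integrals transform covariantly under re-indexing**: `∫ F(ω ∘ e) dμ_K = ∫ F dμ_{K∘(e×e)}` for measurable `F`.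
[cite: BenfattoEtAl1978, §5 p.159] -/
theorem integral_gaussianFieldOfKernel_comp_reindex [DecidableEq ι] [DecidableEq κ] {K : ι → ι → ℝ} (hK : IsPosSemidefKernel K) (e : κ → ι)
    {F : (κ → ℝ) → ℝ} (hF : Measurable F) :
    ∫ ω, F (fun k => ω (e k)) ∂gaussianFieldOfKernel K = ∫ z, F z ∂gaussianFieldOfKernel (fun i j => K (e i) (e j)) := by
  rw [← gaussianFieldOfKernel_map_reindex hK e, integral_map (measurable_reindex e).aemeasurable hF.aestronglyMeasurable]

end Reindex

/-- **DISPLACED PAVEMENTS FOR A NON-INVARIANT FIELD** — the lattice-shift instance on `Q₀ = ℤ^d`: `∫ F(z(· + s)) dμ_G = ∫ F dμ_{G(·+s,·+s)}` for any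
positive semidefinite kernel `G` and measurable `F`; for the free field the shifted kernel is `G` again (`…Translation.freeCov_add_right`) and this is
`…Translation.integral_P0_comp_translate`. [cite: BenfattoEtAl1978, §5 p.159] -/
theorem integral_gaussianFieldOfKernel_comp_add_right {d : ℕ} {G : B1Eq324BenfattoLemma.Site d → B1Eq324BenfattoLemma.Site d → ℝ} (hG : IsPosSemidefKernel G) (s : B1Eq324BenfattoLemma.Site d)
    {F : (B1Eq324BenfattoLemma.Site d → ℝ) → ℝ} (hF : Measurable F) :
    ∫ z, F (fun x => z (x + s)) ∂gaussianFieldOfKernel G = ∫ z, F z ∂gaussianFieldOfKernel (fun x y => G (x + s) (y + s)) :=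
  integral_gaussianFieldOfKernel_comp_reindex hG (fun x => x + s) hF

/-! ## §2  The normal equations: uniqueness of the regression dictionary (any kernel, invertible Gram matrix) -/

section NormalEq

variable {d : ℕ} (G : B1Eq324BenfattoLemma.Site d → B1Eq324BenfattoLemma.Site d → ℝ)

/-- kernel: the canonical coefficient vector `b_{c′} = Σ_c G(x,c)(G_SS)⁻¹_{cc′}` solves the normal equations `b ᵥ* G_SS = G(x,·)|_S`. [folklore] -/
private theorem coefVec_vecMul (S : Finset (B1Eq324BenfattoLemma.Site d)) (hdet : IsUnit (covGram G S).det) (x : B1Eq324BenfattoLemma.Site d) :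
    (fun c' : S => ∑ c : S, G x c * (covGram G S)⁻¹ c c') ᵥ* covGram G S = fun t : S => G x t := by
  funext t
  simp only [Matrix.vecMul, dotProduct]
  calc ∑ c' : S, (∑ c : S, G x c * (covGram G S)⁻¹ c c') * covGram G S c' t
      = ∑ c : S, G x c * ∑ c' : S, (covGram G S)⁻¹ c c' * covGram G S c' t := by
        simp only [Finset.sum_mul, Finset.mul_sum]
        rw [Finset.sum_comm]
        exact Finset.sum_congr rfl fun c _ => Finset.sum_congr rfl fun c' _ => by ring
    _ = ∑ c : S, G x c * ((covGram G S)⁻¹ * covGram G S) c t := by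
        simp only [Matrix.mul_apply]
    _ = G x t := by
        rw [Matrix.nonsing_inv_mul _ hdet]
        simp only [Matrix.one_apply, mul_ite, mul_one, mul_zero, Finset.sum_ite_eq', Finset.mem_univ, if_true]

/-- kernel: a solution of the normal equations IS the canonical coefficient vector (`G_SS` invertible). [folklore] -/
private theorem eq_coefVec_of_normalEq (S : Finset (B1Eq324BenfattoLemma.Site d)) (hdet : IsUnit (covGram G S).det) (x : B1Eq324BenfattoLemma.Site d) (a : B1Eq324BenfattoLemma.Site d → ℝ)
    (ha : ∀ t ∈ S, ∑ s ∈ S, a s * G s t = G x t) :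
    (fun s : S => a s) = fun c' : S => ∑ c : S, G x c * (covGram G S)⁻¹ c c' := by
  have h1 : (fun s : S => a s) ᵥ* covGram G S = fun t : S => G x t := by
    funext t
    simp only [Matrix.vecMul, dotProduct, covGram_apply]
    rw [Finset.sum_coe_sort S (fun s => a s * G s t)]
    exact ha t t.2
  have h2 := coefVec_vecMul G S hdet x
  calc (fun s : S => a s) = ((fun s : S => a s) ᵥ* covGram G S) ᵥ* (covGram G S)⁻¹ := by
        rw [Matrix.vecMul_vecMul, Matrix.mul_nonsing_inv _ hdet, Matrix.vecMul_one]
    _ = ((fun c' : S => ∑ c : S, G x c * (covGram G S)⁻¹ c c') ᵥ* covGram G S) ᵥ* (covGram G S)⁻¹ := by rw [h1, h2]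
    _ = fun c' : S => ∑ c : S, G x c * (covGram G S)⁻¹ c c' := by
        rw [Matrix.vecMul_vecMul, Matrix.mul_nonsing_inv _ hdet, Matrix.vecMul_one]

/-- **Regression coefficients exist**: for an invertible Gram matrix `G_SS` there is `a` with `Σ_{s∈S} a_s G(s,t) = G(x,t)` for all `t ∈ S`
(namely `a = G(x,·)|_S (G_SS)⁻¹`, extended by `0`). [cite: BenfattoEtAl1978, Appendix C 2) (C.6)–(C.7) p.164] -/
theorem exists_normalEq (S : Finset (B1Eq324BenfattoLemma.Site d)) (hdet : IsUnit (covGram G S).det) (x : B1Eq324BenfattoLemma.Site d) :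
    ∃ a : B1Eq324BenfattoLemma.Site d → ℝ, ∀ t ∈ S, ∑ s ∈ S, a s * G s t = G x t := by
  classical
  refine ⟨fun s => if h : s ∈ S then ∑ c : S, G x c * (covGram G S)⁻¹ c ⟨s, h⟩ else 0, fun t ht => ?_⟩
  have h2 := congrFun (coefVec_vecMul G S hdet x) ⟨t, ht⟩
  simp only [Matrix.vecMul, dotProduct, covGram_apply] at h2
  rw [← Finset.sum_coe_sort S]
  convert h2 using 2 with s
  simp only [dif_pos s.2, Subtype.coe_eta]

/-- **THE CONDITIONED COVARIANCE FROM ANY SOLUTION OF THE NORMAL EQUATIONS**: if `Σ_{s∈S} a_s G(s,t) = G(x,t)` for `t ∈ S` (and `G_SS` is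
invertible) then `condCov G S x y = G(x,y) − Σ_{s∈S} a_s G(s,y)` for EVERY `y` — the regression of `z_x` on `z_S` is unique.
[cite: BenfattoEtAl1978, Appendix C 2) (C.6) p.164] -/
theorem condCov_eq_of_normalEq (S : Finset (B1Eq324BenfattoLemma.Site d)) (hdet : IsUnit (covGram G S).det) (x : B1Eq324BenfattoLemma.Site d) (a : B1Eq324BenfattoLemma.Site d → ℝ)
    (ha : ∀ t ∈ S, ∑ s ∈ S, a s * G s t = G x t) (y : B1Eq324BenfattoLemma.Site d) :
    condCov G S x y = G x y - ∑ s ∈ S, a s * G s y := by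
  have hab := eq_coefVec_of_normalEq G S hdet x a ha
  have hcond : condCov G S x y = G x y - ∑ c' : S, (∑ c : S, G x c * (covGram G S)⁻¹ c c') * G c' y := by
    simp only [condCov, Finset.sum_mul]
    rw [Finset.sum_comm]
  rw [hcond, ← Finset.sum_coe_sort S (fun s => a s * G s y)]
  congr 1
  exact Finset.sum_congr rfl fun s _ => by rw [← show (fun s : S => a s) s = a s from rfl, hab]

/-- **THE CONDITIONAL CENTRE FROM ANY SOLUTION OF THE NORMAL EQUATIONS**: under the same hypothesis `condMean G S w x = Σ_{s∈S} a_s w_s` for every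
datum `w`. [cite: BenfattoEtAl1978, Appendix C 2) (C.7) p.164] -/
theorem condMean_eq_of_normalEq (S : Finset (B1Eq324BenfattoLemma.Site d)) (hdet : IsUnit (covGram G S).det) (x : B1Eq324BenfattoLemma.Site d) (a : B1Eq324BenfattoLemma.Site d → ℝ)
    (ha : ∀ t ∈ S, ∑ s ∈ S, a s * G s t = G x t) (w : B1Eq324BenfattoLemma.Site d → ℝ) :
    condMean G S w x = ∑ s ∈ S, a s * w s := by
  have hab := eq_coefVec_of_normalEq G S hdet x a ha
  have hmean : condMean G S w x = ∑ c' : S, (∑ c : S, G x c * (covGram G S)⁻¹ c c') * w c' := by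
    simp only [condMean, Finset.sum_mul]
    rw [Finset.sum_comm]
  rw [hmean, ← Finset.sum_coe_sort S (fun s => a s * w s)]
  exact Finset.sum_congr rfl fun s _ => by rw [← show (fun s : S => a s) s = a s from rfl, hab]

/-- kernel: a two-family coefficient combination summed over `S ⊇ T₁, T₂` splits. [folklore] -/
private theorem sum_indicator_comb {S T₁ T₂ : Finset (B1Eq324BenfattoLemma.Site d)} (h₁ : T₁ ⊆ S) (h₂ : T₂ ⊆ S) (a₁ a₂ g : B1Eq324BenfattoLemma.Site d → ℝ) :
    ∑ s ∈ S, ((if s ∈ T₁ then a₁ s else 0) + (if s ∈ T₂ then a₂ s else 0)) * g s =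
      ∑ s ∈ T₁, a₁ s * g s + ∑ s ∈ T₂, a₂ s * g s := by
  simp only [add_mul, Finset.sum_add_distrib, ite_mul, zero_mul]
  rw [← Finset.sum_filter, ← Finset.sum_filter, Finset.filter_mem_eq_inter, Finset.filter_mem_eq_inter,
    Finset.inter_eq_right.mpr h₁, Finset.inter_eq_right.mpr h₂]

/-- Two-family form of `condCov_eq_of_normalEq` (coefficients on `T₁, T₂ ⊆ S`). [cite: BenfattoEtAl1978, Appendix C 2) (C.6) p.164] -/
theorem condCov_eq_of_normalEq₂ (S : Finset (B1Eq324BenfattoLemma.Site d)) (hdet : IsUnit (covGram G S).det) (x : B1Eq324BenfattoLemma.Site d) {T₁ T₂ : Finset (B1Eq324BenfattoLemma.Site d)}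
    (h₁ : T₁ ⊆ S) (h₂ : T₂ ⊆ S) (a₁ a₂ : B1Eq324BenfattoLemma.Site d → ℝ)
    (ha : ∀ t ∈ S, ∑ s ∈ T₁, a₁ s * G s t + ∑ s ∈ T₂, a₂ s * G s t = G x t) (y : B1Eq324BenfattoLemma.Site d) :
    condCov G S x y = G x y - (∑ s ∈ T₁, a₁ s * G s y + ∑ s ∈ T₂, a₂ s * G s y) := by
  classical
  have key := condCov_eq_of_normalEq G S hdet x (fun s => (if s ∈ T₁ then a₁ s else 0) + (if s ∈ T₂ then a₂ s else 0))
    (fun t ht => by rw [sum_indicator_comb h₁ h₂]; exact ha t ht) y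
  rwa [sum_indicator_comb h₁ h₂] at key

/-- Two-family form of `condMean_eq_of_normalEq`. [cite: BenfattoEtAl1978, Appendix C 2) (C.7) p.164] -/
theorem condMean_eq_of_normalEq₂ (S : Finset (B1Eq324BenfattoLemma.Site d)) (hdet : IsUnit (covGram G S).det) (x : B1Eq324BenfattoLemma.Site d) {T₁ T₂ : Finset (B1Eq324BenfattoLemma.Site d)}
    (h₁ : T₁ ⊆ S) (h₂ : T₂ ⊆ S) (a₁ a₂ : B1Eq324BenfattoLemma.Site d → ℝ)
    (ha : ∀ t ∈ S, ∑ s ∈ T₁, a₁ s * G s t + ∑ s ∈ T₂, a₂ s * G s t = G x t) (w : B1Eq324BenfattoLemma.Site d → ℝ) :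
    condMean G S w x = ∑ s ∈ T₁, a₁ s * w s + ∑ s ∈ T₂, a₂ s * w s := by
  classical
  have key := condMean_eq_of_normalEq G S hdet x (fun s => (if s ∈ T₁ then a₁ s else 0) + (if s ∈ T₂ then a₂ s else 0))
    (fun t ht => by rw [sum_indicator_comb h₁ h₂]; exact ha t ht) w
  rwa [sum_indicator_comb h₁ h₂] at key

end NormalEq

/-! ## §3  The Schur complement of a positive definite Gram matrix is positive definite -/

section Schur

variable {d : ℕ} {G : B1Eq324BenfattoLemma.Site d → B1Eq324BenfattoLemma.Site d → ℝ}

/-- **Principal sub-Gram-matrices of a positive definite Gram matrix are positive definite** (`T ⊆ S`). [folklore]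
[cite: BenfattoEtAl1978, Appendix C 2) p.164] -/
theorem posDef_covGram_of_subset {S T : Finset (B1Eq324BenfattoLemma.Site d)} (hTS : T ⊆ S) (hS : (covGram G S).PosDef) : (covGram G T).PosDef := by
  have hinj : Function.Injective (fun t : T => (⟨t.1, hTS t.2⟩ : S)) :=
    fun a b hab => Subtype.ext (by simpa using congrArg Subtype.val hab)
  have h := hS.submatrix hinj
  rwa [covGram_submatrix G hTS] at h

/-- **THE CONDITIONED VARIABLES OFF `C` ARE NON-DEGENERATE** for ANY kernel whose Gram matrix on `C ∪ Γ` is positive definite (`Γ ∩ C = ∅`): the Gram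
matrix of the Schur-complement covariance `condCov G C` on `Γ` is positive DEFINITE — it is the Schur complement `D − BᵀA⁻¹B` of the block `A = G_CC` in
`G_{(C∪Γ)(C∪Γ)}`, and `wᵀ G_{C∪Γ} w = vᵀ(D − BᵀA⁻¹B)v` at `w = (−A⁻¹Bv, v)` (Mathlib `Matrix.schur_complement_eq₁₁`).  For the free field this is
`…TwoStage.posDef_covGram_condCov_freeCov` (there by the maximum principle). [cite: BenfattoEtAl1978, Appendix C 2) (C.6)–(C.7) p.164] -/
theorem posDef_covGram_condCov_of_posDef (C Γ : Finset (B1Eq324BenfattoLemma.Site d)) (hdisj : Disjoint Γ C) (hPD : (covGram G (C ∪ Γ)).PosDef) :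
    (covGram (condCov G C) Γ).PosDef := by
  classical
  -- symmetry of `G` on `C ∪ Γ`
  have hsym : ∀ s t : B1Eq324BenfattoLemma.Site d, s ∈ C ∪ Γ → t ∈ C ∪ Γ → G s t = G t s := by
    intro s t hs ht
    have h := hPD.isHermitian.apply ⟨s, hs⟩ ⟨t, ht⟩
    simpa [covGram_apply] using h.symm
  -- the blocks
  set A : Matrix C C ℝ := covGram G C with hA
  set B : Matrix C Γ ℝ := Matrix.of fun (c : C) (γ : Γ) => G c γ with hB
  set D : Matrix Γ Γ ℝ := covGram G Γ with hD
  have hAPD : A.PosDef := posDef_covGram_of_subset Finset.subset_union_left hPD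
  letI : Invertible A := hAPD.isUnit.invertible
  -- the Gram matrix on `C ∪ Γ`, re-indexed by `C ⊕ Γ`, is the block matrix
  set e := Equiv.Finset.union C Γ hdisj.symm with he
  have hblock : (covGram G (C ∪ Γ)).submatrix e e = Matrix.fromBlocks A B Bᴴ D := by
    ext i j
    rcases i with i | i <;> rcases j with j | j
    · simp [hA, he, Matrix.fromBlocks, covGram_apply]
    · simp [hB, he, Matrix.fromBlocks, covGram_apply]
    · simp only [Matrix.submatrix_apply, covGram_apply, Matrix.fromBlocks_apply₂₁, Matrix.conjTranspose_apply, star_trivial, hB,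
        Matrix.of_apply, he, Equiv.Finset.union_inr, Equiv.Finset.union_inl]
      exact hsym _ _ (Finset.mem_union_right _ i.2) (Finset.mem_union_left _ j.2)
    · simp [hD, he, Matrix.fromBlocks, covGram_apply]
  have hPD' : (Matrix.fromBlocks A B Bᴴ D).PosDef := by
    rw [← hblock]
    exact hPD.submatrix e.injective
  -- the Schur complement is the Gram matrix of `condCov G C` on `Γ`
  have hschur : D - Bᴴ * A⁻¹ * B = covGram (condCov G C) Γ := by
    ext γ γ'
    simp only [Matrix.sub_apply, hD, covGram_apply, condCov, Matrix.mul_apply, hB, Matrix.conjTranspose_apply, Matrix.of_apply,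
      star_trivial, hA, Finset.sum_mul]
    congr 1
    rw [Finset.sum_comm]
    refine Finset.sum_congr rfl fun c _ => Finset.sum_congr rfl fun c' _ => ?_
    rw [hsym _ _ (Finset.mem_union_right _ γ.2) (Finset.mem_union_left _ c.2)]
  -- Hermitian
  have hherm : (covGram (condCov G C) Γ).IsHermitian := by
    rw [← hschur]
    exact (Matrix.IsHermitian.fromBlocks₁₁ B D hAPD.isHermitian).mp hPD'.isHermitian
  refine Matrix.PosDef.of_dotProduct_mulVec_pos hherm fun v hv => ?_
  -- test the block matrix at `w = (−A⁻¹Bv) ⊕ v`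
  set x : C → ℝ := -((A⁻¹ * B) *ᵥ v) with hx
  have hw : Sum.elim x v ≠ 0 := fun hw => hv (funext fun γ => by simpa using congrFun hw (Sum.inr γ))
  have hpos := hPD'.dotProduct_mulVec_pos hw
  rw [Matrix.dotProduct_mulVec, Matrix.schur_complement_eq₁₁ B D x v hAPD.isHermitian, hx, neg_add_cancel] at hpos
  simp only [star_zero, Matrix.zero_vecMul, dotProduct_zero, zero_add] at hpos
  rwa [hschur, ← Matrix.dotProduct_mulVec] at hpos

/-- **The Gram matrix of `condCov G C` on `Γ` is invertible** (so the second-stage regression dictionary is the exact one).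
[cite: BenfattoEtAl1978, Appendix C 2) p.164] -/
theorem isUnit_det_covGram_condCov_of_posDef (C Γ : Finset (B1Eq324BenfattoLemma.Site d)) (hdisj : Disjoint Γ C) (hPD : (covGram G (C ∪ Γ)).PosDef) :
    IsUnit (covGram (condCov G C) Γ).det :=
  (Matrix.isUnit_iff_isUnit_det _).1 (posDef_covGram_condCov_of_posDef C Γ hdisj hPD).isUnit

end Schur

/-! ## §4  Conditioning in two stages: `C^{C∪Γ} = (C^C)^Γ` and the centre, for a general kernel -/

section TwoStage

variable {d : ℕ} {G : B1Eq324BenfattoLemma.Site d → B1Eq324BenfattoLemma.Site d → ℝ}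

/-- kernel: the algebra of substituting the first-stage regression into the second. [folklore] -/
private theorem twoStage_algebra (C Γ : Finset (B1Eq324BenfattoLemma.Site d)) (κ : B1Eq324BenfattoLemma.Site d → B1Eq324BenfattoLemma.Site d → ℝ) (lam : B1Eq324BenfattoLemma.Site d → ℝ) (g : B1Eq324BenfattoLemma.Site d → ℝ) (x : B1Eq324BenfattoLemma.Site d) :
    (g x - ∑ c ∈ C, κ x c * g c) - ∑ γ ∈ Γ, lam γ * (g γ - ∑ c ∈ C, κ γ c * g c) =
      g x - (∑ c ∈ C, (κ x c - ∑ γ ∈ Γ, lam γ * κ γ c) * g c + ∑ γ ∈ Γ, lam γ * g γ) := by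
  have h : ∑ γ ∈ Γ, lam γ * (g γ - ∑ c ∈ C, κ γ c * g c) =
      ∑ γ ∈ Γ, lam γ * g γ - ∑ c ∈ C, (∑ γ ∈ Γ, lam γ * κ γ c) * g c := by
    simp only [mul_sub, Finset.sum_sub_distrib, Finset.mul_sum, Finset.sum_mul]
    congr 1
    rw [Finset.sum_comm]
    exact Finset.sum_congr rfl fun c _ => Finset.sum_congr rfl fun γ _ => by ring
  rw [h]
  simp only [sub_mul, Finset.sum_sub_distrib]
  ring

/-- kernel: the combined coefficients solve the normal equations on `C ∪ Γ`. [folklore] -/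
private theorem normalEq_union (C Γ : Finset (B1Eq324BenfattoLemma.Site d)) (x : B1Eq324BenfattoLemma.Site d)
    (κ : B1Eq324BenfattoLemma.Site d → B1Eq324BenfattoLemma.Site d → ℝ) (hκ : ∀ z, ∀ t ∈ C, ∑ s ∈ C, κ z s * G s t = G z t)
    (hK' : ∀ z y, condCov G C z y = G z y - ∑ s ∈ C, κ z s * G s y)
    (lam : B1Eq324BenfattoLemma.Site d → ℝ) (hlam : ∀ t ∈ Γ, ∑ γ ∈ Γ, lam γ * condCov G C γ t = condCov G C x t) :
    ∀ t ∈ C ∪ Γ, ∑ c ∈ C, (κ x c - ∑ γ ∈ Γ, lam γ * κ γ c) * G c t + ∑ γ ∈ Γ, lam γ * G γ t = G x t := by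
  intro t ht
  -- rewrite the left side as `Σ_c κ x c G c t + Σ_γ λ γ · condCov G C γ t`
  have hre : ∑ c ∈ C, (κ x c - ∑ γ ∈ Γ, lam γ * κ γ c) * G c t + ∑ γ ∈ Γ, lam γ * G γ t =
      ∑ c ∈ C, κ x c * G c t + ∑ γ ∈ Γ, lam γ * condCov G C γ t := by
    have h := twoStage_algebra C Γ κ lam (fun s => G s t) x
    simp only [hK']
    linarith
  rw [hre]
  rcases Finset.mem_union.mp ht with htC | htΓ
  · -- on `C`: the first sum is `G x t`, and `condCov G C γ t = 0`
    have h0 : ∀ γ ∈ Γ, condCov G C γ t = 0 := fun γ _ => by rw [hK', hκ γ t htC, sub_self]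
    rw [hκ x t htC, Finset.sum_eq_zero fun γ hγ => by rw [h0 γ hγ, mul_zero], add_zero]
  · -- on `Γ`: the second sum is `condCov G C x t = G x t − Σ_c κ x c G c t`
    rw [hlam t htΓ, hK']
    ring

/-- **TWO-STAGE CONDITIONING OF THE COVARIANCE, general kernel** — for disjoint finite `C`, `Γ` and a kernel `G` whose Gram matrix on `C ∪ Γ` is
positive definite, `condCov G (C ∪ Γ) x y = condCov (condCov G C) Γ x y` for all `x, y` («the Dirichlet covariance on C∪Γ is the Dirichlet covariance,
on Γ, of the Dirichlet covariance on C» — the quotient property of Schur complements).  Proof: substitute the first-stage regression into the second;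
the combined coefficients solve the normal equations on `C ∪ Γ`; uniqueness (§2).  For `G = freeCov d α β` this is `…TwoStage.condCov_union_eq`.
[cite: BenfattoEtAl1978, p.152 «P̂₀(dz|(z̄_Δ)_{Δ∈C})», §5 (5.13) p.155, p.159; Appendix C 2) p.164] -/
theorem condCov_union_eq_of_posDef (C Γ : Finset (B1Eq324BenfattoLemma.Site d)) (hdisj : Disjoint Γ C) (hPD : (covGram G (C ∪ Γ)).PosDef) (x y : B1Eq324BenfattoLemma.Site d) :
    condCov G (C ∪ Γ) x y = condCov (condCov G C) Γ x y := by
  classical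
  have hdetU : IsUnit (covGram G (C ∪ Γ)).det := (Matrix.isUnit_iff_isUnit_det _).1 hPD.isUnit
  have hdetC : IsUnit (covGram G C).det :=
    (Matrix.isUnit_iff_isUnit_det _).1 (posDef_covGram_of_subset Finset.subset_union_left hPD).isUnit
  have hdetΓ' := isUnit_det_covGram_condCov_of_posDef C Γ hdisj hPD
  -- first-stage coefficients `κ z ·` for every `z`, second-stage coefficients `λ` for `x`
  choose κ hκ using fun z => exists_normalEq G C hdetC z
  have hK' : ∀ z y, condCov G C z y = G z y - ∑ s ∈ C, κ z s * G s y :=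
    fun z y => condCov_eq_of_normalEq G C hdetC z (κ z) (hκ z) y
  obtain ⟨lam, hlam⟩ := exists_normalEq (condCov G C) Γ hdetΓ' x
  have hN := normalEq_union C Γ x κ hκ hK' lam hlam
  -- both sides in coefficient form
  rw [condCov_eq_of_normalEq₂ G (C ∪ Γ) hdetU x Finset.subset_union_left Finset.subset_union_right _ lam hN y,
    condCov_eq_of_normalEq (condCov G C) Γ hdetΓ' x lam hlam y, hK' x y]
  simp only [hK']
  exact (twoStage_algebra C Γ κ lam (fun s => G s y) x).symm

/-- **On `C` the second-stage covariance still vanishes**: `condCov (condCov G C) Γ c y = 0 = condCov (condCov G C) Γ y c` for `c ∈ C` (it is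
`condCov G (C ∪ Γ)`, which vanishes on `C ∪ Γ` in either argument — `…Markov.condCov_of_mem_left∕right`).  For the free field:
`…TwoStage.condCov_condCov_of_mem`. [cite: BenfattoEtAl1978, Appendix C 2) (C.6) p.164] -/
theorem condCov_condCov_of_mem_of_posDef (hG : ∀ x y, G x y = G y x) (C Γ : Finset (B1Eq324BenfattoLemma.Site d)) (hdisj : Disjoint Γ C)
    (hPD : (covGram G (C ∪ Γ)).PosDef) {c : B1Eq324BenfattoLemma.Site d} (hc : c ∈ C) (y : B1Eq324BenfattoLemma.Site d) :
    condCov (condCov G C) Γ c y = 0 ∧ condCov (condCov G C) Γ y c = 0 := by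
  have hdetU : IsUnit (covGram G (C ∪ Γ)).det := (Matrix.isUnit_iff_isUnit_det _).1 hPD.isUnit
  have hcU : c ∈ C ∪ Γ := Finset.mem_union_left _ hc
  refine ⟨?_, ?_⟩
  · rw [← condCov_union_eq_of_posDef C Γ hdisj hPD]
    exact B1Eq324BenfattoMarkov.condCov_of_mem_left (C ∪ Γ) hdetU hcU y
  · rw [← condCov_union_eq_of_posDef C Γ hdisj hPD]
    exact B1Eq324BenfattoMarkov.condCov_of_mem_right hG (C ∪ Γ) hdetU y hcU

/-- **TWO-STAGE CONDITIONING OF THE CENTRE, general kernel**: `condMean G (C ∪ Γ) w x = condMean G C w x + condMean (condCov G C) Γ (w − condMean G C w) x`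
— the centre given `z_{C∪Γ} = w` is the centre given `z_C = w|_C` corrected by the `condCov G C`-regression of the residual datum on `Γ`.  For the
free field this is `…TwoStage.condMean_union_eq`. [cite: BenfattoEtAl1978, p.152, §5 p.159; Appendix C 2) (C.7) p.164] -/
theorem condMean_union_eq_of_posDef (C Γ : Finset (B1Eq324BenfattoLemma.Site d)) (hdisj : Disjoint Γ C) (hPD : (covGram G (C ∪ Γ)).PosDef)
    (w : B1Eq324BenfattoLemma.Site d → ℝ) (x : B1Eq324BenfattoLemma.Site d) :
    condMean G (C ∪ Γ) w x =
      condMean G C w x + condMean (condCov G C) Γ (fun t => w t - condMean G C w t) x := by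
  classical
  have hdetU : IsUnit (covGram G (C ∪ Γ)).det := (Matrix.isUnit_iff_isUnit_det _).1 hPD.isUnit
  have hdetC : IsUnit (covGram G C).det :=
    (Matrix.isUnit_iff_isUnit_det _).1 (posDef_covGram_of_subset Finset.subset_union_left hPD).isUnit
  have hdetΓ' := isUnit_det_covGram_condCov_of_posDef C Γ hdisj hPD
  choose κ hκ using fun z => exists_normalEq G C hdetC z
  have hK' : ∀ z y, condCov G C z y = G z y - ∑ s ∈ C, κ z s * G s y :=
    fun z y => condCov_eq_of_normalEq G C hdetC z (κ z) (hκ z) y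
  have hM : ∀ z, condMean G C w z = ∑ s ∈ C, κ z s * w s :=
    fun z => condMean_eq_of_normalEq G C hdetC z (κ z) (hκ z) w
  obtain ⟨lam, hlam⟩ := exists_normalEq (condCov G C) Γ hdetΓ' x
  have hN := normalEq_union C Γ x κ hκ hK' lam hlam
  rw [condMean_eq_of_normalEq₂ G (C ∪ Γ) hdetU x Finset.subset_union_left Finset.subset_union_right _ lam hN w,
    condMean_eq_of_normalEq (condCov G C) Γ hdetΓ' x lam hlam, hM x]
  simp only [hM]
  have h := twoStage_algebra C Γ κ lam w x
  -- `h : (w x − Σκw) − Σλ(w − Σκw) = w x − (Σ(κ−Σλκ)w + Σλw)`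
  linarith

end TwoStage

end Literature.MathematicalPhysics.QuantumFieldTheory.Balaban1983to89.B1Eq324BenfattoCondKernelGeneric

end
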